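import Mathlib.Algebra.BigOperators.Fin
import Mathlib.Algebra.Order.BigOperators.Group.Finset
import Literature.Computability.Complexity.CircuitComposition
import Literature.Computability.Complexity.CircuitRestriction
import HarnessLib

/-!
# Building unbounded fan-in circuits of prescribed depth (trunk `CplxCore`)

A small compositional toolkit for *constructing* `AC⁰`-type circuits in the tree's model
(`Circuit ι`: straight-line programs; `acBasis = {¬} ∪ {∧ₖ, ∨ₖ}`; `Circuit.acDepth`: depth
with negations free) with simultaneous control of **depth** and **size**:

* `ACReal f d s` — the Boolean function `f : (ι → Bool) → Bool` is computed by the output wire of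
  some well-formed gate list over `acBasis` with at most `s` gates, the output wire having
  `acWeight`-depth at most `d`;
* closure: input literals (`acReal_input`, `acReal_notInput`, depth `0`), constants
  (`acReal_const`, depth `1`), negation (`ACReal.neg`, depth unchanged), and unbounded fan-in
  conjunction/disjunction of a finite family (`acReal_forall`, `acReal_exists`: depth `+ 1`,
  sizes add `+ 1`) — the textbook inductive description of depth-`d` formulas/circuits
  (Vollmer 1999, §1.2; Arora–Barak 2009, §14.1);
* `ACReal.toCircuit` — extraction of a genuine `Circuit ι` with `IsOver acBasis`,
  `acDepth ≤ d`, `size ≤ s`, computing `f`.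

The technical core is the juxtaposition of independent blocks (`GateList.vals_append_par`,
`GateList.wdepths_append_par`: appending a gate list relocated behind another one *without*
rewiring its inputs evaluates both, values and depths, side by side), the depth companion of
`GateList.vals_append_reloc` of `CircuitComposition.lean`. Intended consumer: the `PH ↦ AC⁰`
conversion of oracle predicates (Furst–Saxe–Sipser 1984; Ko 1989, Lemmas 2.1 and 2.3) in the
Raz–Tal oracle-separation files of `QuantumComplexity/`. `ACReal.toCircuit` / `ACReal.of_circuit`
record that `ACReal f d s` is exactly "some circuit over `acBasis` of `acDepth ≤ d` and
`size ≤ s` computes `f`". Mathlib has no Boolean circuits.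

## References

* H. Vollmer, *Introduction to Circuit Complexity* (1999), §1.2.
* S. Arora, B. Barak, *Computational Complexity: A Modern Approach* (2009), Def. 6.1, §14.1.
-/

namespace Literature.Computability.Complexity

open Finset GateList

variable {ι : Type*}

namespace GateList

/-! ### Juxtaposition of independent gate lists -/

/-- Relocating a gate list behind `L` gates while keeping its input wires (`ρ = inl`). [cite: Vollmer1999, §1.2] -/
abbrev par (L : ℕ) (g : Gate ι) : Gate ι := reloc Sum.inl L g

/-- A wire of the second block, shifted behind the first block, reads the second block's values. [folklore] -/
theorem wireOf_shift_par (x : ι → Bool) (vs ws : List Bool) (w : ι ⊕ ℕ) :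
    wireOf x (vs ++ ws) (shiftWire Sum.inl vs.length w) = wireOf x ws w := by
  rw [wireOf_shiftWire x vs ws rfl Sum.inl (wiresOK_inl _ _root_.id) w]
  rfl

/-- **Values of juxtaposed blocks**: the values of `gs ++ gs'` (the second block relocated but
not rewired) are the values of `gs` followed by the values of `gs'`. [cite: Vollmer1999, §1.2] -/
theorem vals_append_par (gs gs' : List (Gate ι)) (x : ι → Bool) :
    vals (gs ++ gs'.map (par gs.length)) x = vals gs x ++ vals gs' x := by
  rw [vals_append_reloc gs gs' Sum.inl (wiresOK_inl _ _root_.id) x]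
  rfl

/-- A shifted wire has the depth it had in the second block. [folklore] -/
theorem wireDepthOf_shift_par (ds ws : List ℕ) (w : ι ⊕ ℕ) :
    wireDepthOf (ds ++ ws) (shiftWire (Sum.inl : ι → ι ⊕ ℕ) ds.length w) = wireDepthOf ws w := by
  cases w with
  | inl i => rfl
  | inr m =>
    simp only [shiftWire, wireDepthOf_inr, List.getD_eq_getElem?_getD]
    rw [List.getElem?_append_right (by omega)]
    congr 2
    omega

/-- **Depths of juxtaposed blocks**: the depths of `gs ++ gs'` (second block relocated, not
rewired) are the depths of `gs` followed by the depths of `gs'`. [cite: Vollmer1999, §1.2] -/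
theorem wdepths_append_par (w : GateFn → ℕ) (gs gs' : List (Gate ι)) :
    wdepths w (gs ++ gs'.map (par gs.length)) = wdepths w gs ++ wdepths w gs' := by
  induction gs' using List.reverseRecOn with
  | nil => simp
  | append_singleton gs' g ih =>
    rw [List.map_append, List.map_singleton, ← List.append_assoc, wdepths_append_singleton, ih,
      wdepths_append_singleton, List.append_assoc]
    congr 2
    simp only [reloc_fn, List.cons.injEq, and_true]
    congr 1
    refine Finset.sup_congr rfl fun a _ => ?_
    have hlen : (wdepths w gs).length = gs.length := length_wdepths w gs
    rw [← hlen]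
    exact wireDepthOf_shift_par (wdepths w gs) (wdepths w gs') (g.args a)

/-- The output wire of the first block keeps its value in the juxtaposition. [folklore] -/
theorem wireOf_append_left (x : ι → Bool) (gs gs' : List (Gate ι)) {o : ι ⊕ ℕ}
    (ho : OutOK gs.length o) : wireOf x (vals (gs ++ gs') x) o = wireOf x (vals gs x) o := by
  obtain ⟨ws, hws⟩ := vals_append_take gs gs' x
  rw [hws]
  exact wireOf_append_of_lt x _ _ o (by simpa using ho)

end GateList

/-! ### Realizability with depth and size -/

/-- `ACReal f d s`: some well-formed gate list over `acBasis` with at most `s` gates has an output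
wire of `acWeight`-depth at most `d` carrying `f x` on every input `x` (Vollmer 1999, §1.2:
circuits of depth `d` and size `s` over the unbounded fan-in basis, negations not counted in the
depth). [cite: Vollmer1999, §1.2] -/
def ACReal (f : (ι → Bool) → Bool) (d s : ℕ) : Prop :=
  ∃ (gs : List (Gate ι)) (o : ι ⊕ ℕ), WF gs ∧ (∀ g ∈ gs, g.fn ∈ acBasis) ∧ OutOK gs.length o ∧
    gs.length ≤ s ∧ wireDepthOf (wdepths acWeight gs) o ≤ d ∧ ∀ x, wireOf x (vals gs x) o = f x

namespace ACReal

variable {f g : (ι → Bool) → Bool} {d d' s s' : ℕ}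

/-- Monotonicity in depth and size. [folklore] -/
theorem mono (h : ACReal f d s) (hd : d ≤ d') (hs : s ≤ s') : ACReal f d' s' := by
  obtain ⟨gs, o, hwf, hB, ho, hl, hdep, hev⟩ := h
  exact ⟨gs, o, hwf, hB, ho, hl.trans hs, hdep.trans hd, hev⟩

/-- Extensionality in the computed function. [folklore] -/
theorem congr (h : ACReal f d s) (hfg : ∀ x, f x = g x) : ACReal g d s := by
  obtain ⟨gs, o, hwf, hB, ho, hl, hdep, hev⟩ := h
  exact ⟨gs, o, hwf, hB, ho, hl, hdep, fun x => (hev x).trans (hfg x)⟩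

/-- **Extraction of a circuit** with the recorded basis, depth, size and semantics
(Arora–Barak 2009, Rem. 6.4: straight-line programs are circuits). [cite: AroraBarakCC2009, Rem. 6.4] -/
theorem toCircuit (h : ACReal f d s) :
    ∃ C : Circuit ι, C.IsOver acBasis ∧ C.acDepth ≤ d ∧ C.size ≤ s ∧ ∀ x, C.eval x = f x := by
  obtain ⟨gs, o, hwf, hB, ho, hl, hdep, hev⟩ := h
  refine ⟨⟨gs, o, fun j hj a m ha => hwf j _ (List.getElem?_eq_getElem hj) a m ha, ho⟩,
    hB, ?_, hl, fun x => ?_⟩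
  · change Circuit.depthWith _ acWeight ≤ d
    rw [circuit_depthWith]
    exact hdep
  · cases o with
    | inl i => exact hev x
    | inr m => exact hev x

/-- **The converse**: a circuit over `acBasis` of `acDepth ≤ d` and size `≤ s` realizes its own
function, so `ACReal` is exactly the circuit notion (Arora–Barak 2009, Rem. 6.4). [cite: AroraBarakCC2009, Rem. 6.4] -/
theorem of_circuit (C : Circuit ι) (hB : C.IsOver acBasis) (hd : C.acDepth ≤ d) (hs : C.size ≤ s) :
    ACReal C.eval d s := by
  refine ⟨C.gates, C.output, wf_gates C, hB, C.wf_output, hs, ?_, fun x => ?_⟩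
  · have h := circuit_depthWith C acWeight
    change C.acDepth = _ at h
    rw [← h]; exact hd
  · obtain ⟨gs, o, hwf, ho⟩ := C
    cases o with
    | inl i => rfl
    | inr m => rfl

end ACReal

/-! ### Literals, constants, negation -/

/-- An input literal `xᵢ` is realized at depth `0` with no gate. [cite: Vollmer1999, §1.2] -/
theorem acReal_input (i : ι) : ACReal (fun x : ι → Bool => x i) 0 0 :=
  ⟨[], Sum.inl i, WF.nil, by simp, (fun m h => by cases h), le_rfl, le_rfl, fun _ => rfl⟩

/-- A negated input literal `¬xᵢ` is realized at depth `0` with one (free) negation gate. [cite: Vollmer1999, §1.2] -/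
theorem acReal_notInput (i : ι) : ACReal (fun x : ι → Bool => !x i) 0 1 := by
  refine ⟨[notGate (Sum.inl i)], Sum.inr 0, ?_, ?_, ?_, le_rfl, ?_, fun x => ?_⟩
  · exact WF.singleton fun a m h => by cases h
  · intro g hg
    simp only [List.mem_singleton] at hg
    subst hg
    exact mem_acBasis_not
  · intro m hm; cases hm; simp
  · simp only [wireDepthOf_inr]
    rw [getD_wdepths_singleton, notGate_fn, acWeight_not, zero_add]
    exact Finset.sup_le fun a _ => by simp [notGate]
  · simp [vals, notGate]

/-- The gate of a constant, as a gate of a straight-line program: `∧₀` (`true`) or `∨₀`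
(`false`). [cite: Vollmer1999, §1.1] -/
def constGate (b : Bool) : Gate ι := ⟨0, fun _ => b, Fin.elim0⟩

/-- Its gate function is `GateFn.const b ∈ acBasis`. [folklore] -/
theorem constGate_fn (b : Bool) : (constGate (ι := ι) b).fn = GateFn.const b := rfl

/-- A constant is realized at depth `1` with one gate (`∧₀` or `∨₀`). [cite: Vollmer1999, §1.2] -/
theorem acReal_const (b : Bool) : ACReal (fun _ : ι → Bool => b) 1 1 := by
  refine ⟨[constGate b], Sum.inr 0, ?_, ?_, ?_, le_rfl, ?_, fun x => ?_⟩
  · exact WF.singleton fun a => a.elim0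
  · intro g hg
    simp only [List.mem_singleton] at hg
    subst hg
    rw [constGate_fn]
    exact const_mem_acBasis b
  · intro m hm; cases hm; simp
  · simp only [wireDepthOf_inr]
    rw [getD_wdepths_singleton, constGate_fn, acWeight_const]
    simp [constGate]
  · simp [vals, constGate]

/-- **Negation is free**: appending a `¬` gate on the output wire keeps the depth and adds one
gate. [cite: Vollmer1999, §1.2] -/
theorem ACReal.neg {f : (ι → Bool) → Bool} {d s : ℕ} (h : ACReal f d s) :
    ACReal (fun x => !f x) d (s + 1) := by
  obtain ⟨gs, o, hwf, hB, ho, hl, hdep, hev⟩ := h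
  refine ⟨gs ++ [notGate o], Sum.inr gs.length, ?_, ?_, ?_, by simpa using hl, ?_, fun x => ?_⟩
  · exact hwf.append_singleton fun a m h => ho m h
  · intro g hg
    rw [List.mem_append, List.mem_singleton] at hg
    rcases hg with hg | rfl
    · exact hB g hg
    · exact mem_acBasis_not
  · intro m hm
    simp only [Sum.inr.injEq] at hm
    subst hm; simp
  · simp only [wireDepthOf_inr]
    rw [getD_wdepths_append_singleton, notGate_fn, acWeight_not, zero_add]
    refine Finset.sup_le fun a _ => ?_
    simpa [notGate] using hdep
  · simp only [wireOf_inr]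
    rw [vals_append_singleton, List.getD_eq_getElem?_getD,
      List.getElem?_append_right (by simp), length_vals, Nat.sub_self]
    simp [notGate, hev x]

/-! ### Unbounded fan-in conjunction and disjunction -/

namespace GateList

/-- Juxtaposition of a list of blocks (gate list with output wire): the blocks are laid side by
side, each relocated behind the previous ones; returns the combined gate list and the list of the
(shifted) output wires. [cite: Vollmer1999, §1.2] -/
def parBlocks : List (List (Gate ι) × (ι ⊕ ℕ)) → List (Gate ι) × List (ι ⊕ ℕ)
  | [] => ([], [])
  | (gs, o) :: rest =>
    ((gs ++ (parBlocks rest).1.map (par gs.length)),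
      o :: (parBlocks rest).2.map (shiftWire Sum.inl gs.length))

/-- The combined gate list is as long as the blocks together. [folklore] -/
theorem length_parBlocks_fst : ∀ bs : List (List (Gate ι) × (ι ⊕ ℕ)),
    (parBlocks bs).1.length = (bs.map fun b => b.1.length).sum
  | [] => rfl
  | (gs, o) :: rest => by
    simp [parBlocks, length_parBlocks_fst rest]

/-- There is one output wire per block. [folklore] -/
theorem length_parBlocks_snd : ∀ bs : List (List (Gate ι) × (ι ⊕ ℕ)),
    (parBlocks bs).2.length = bs.length
  | [] => rfl
  | (gs, o) :: rest => by simp [parBlocks, length_parBlocks_snd rest]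

/-- The combined gate list is well formed if the blocks are. [folklore] -/
theorem wf_parBlocks : ∀ bs : List (List (Gate ι) × (ι ⊕ ℕ)), (∀ b ∈ bs, WF b.1) →
    WF (parBlocks bs).1
  | [], _ => WF.nil
  | (gs, o) :: rest, h => by
    simp only [parBlocks]
    exact (h (gs, o) (by simp)).append_reloc (wf_parBlocks rest fun b hb => h b (by simp [hb]))
      (wiresOK_inl _ _root_.id)

/-- The gates of the combined list are gates of the blocks (up to relocation, which keeps the
gate function). [folklore] -/
theorem fn_mem_parBlocks {B : Set GateFn} : ∀ bs : List (List (Gate ι) × (ι ⊕ ℕ)),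
    (∀ b ∈ bs, ∀ g ∈ b.1, g.fn ∈ B) → ∀ g ∈ (parBlocks bs).1, g.fn ∈ B
  | [], _, g, hg => by simp [parBlocks] at hg
  | (gs, o) :: rest, h, g, hg => by
    simp only [parBlocks, List.mem_append, List.mem_map] at hg
    rcases hg with hg | ⟨g', hg', rfl⟩
    · exact h (gs, o) (by simp) g hg
    · rw [reloc_fn]
      exact fn_mem_parBlocks rest (fun b hb => h b (by simp [hb])) g' hg'

/-- Each output wire of the juxtaposition is a valid wire of the combined list. [folklore] -/
theorem outOK_parBlocks : ∀ bs : List (List (Gate ι) × (ι ⊕ ℕ)), (∀ b ∈ bs, OutOK b.1.length b.2) →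
    ∀ o ∈ (parBlocks bs).2, OutOK (parBlocks bs).1.length o
  | [], _, o, ho => by simp [parBlocks] at ho
  | (gs, o') :: rest, h, o, ho => by
    simp only [parBlocks, List.mem_cons, List.mem_map] at ho
    simp only [parBlocks, List.length_append, List.length_map]
    rcases ho with rfl | ⟨u, hu, rfl⟩
    · intro m hm
      exact (h (gs, o) (by simp) m hm).trans_le (Nat.le_add_right _ _)
    · have hu' := outOK_parBlocks rest (fun b hb => h b (by simp [hb])) u hu
      intro m hm
      cases u with
      | inl i => cases hm
      | inr m' =>
        simp only [shiftWire, Sum.inr.injEq] at hm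
        have := hu' m' rfl
        omega

/-- **Semantics of the juxtaposition**: the `k`-th output wire carries the value of the `k`-th
block. [cite: Vollmer1999, §1.2] -/
theorem wireOf_parBlocks (x : ι → Bool) : ∀ (bs : List (List (Gate ι) × (ι ⊕ ℕ))),
    (∀ b ∈ bs, OutOK b.1.length b.2) → ∀ (k : ℕ) (hk : k < (parBlocks bs).2.length) (hk' : k < bs.length),
      wireOf x (vals (parBlocks bs).1 x) ((parBlocks bs).2[k]) = wireOf x (vals (bs[k]).1 x) (bs[k]).2
  | [], _, k, hk, _ => by simp [parBlocks] at hk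
  | (gs, o) :: rest, h, 0, _, _ => by
    simp only [parBlocks, List.getElem_cons_zero]
    exact wireOf_append_left x gs _ (h (gs, o) (by simp))
  | (gs, o) :: rest, h, k + 1, hk, hk' => by
    simp only [parBlocks, List.getElem_cons_succ, List.getElem_map]
    rw [vals_append_par]
    have e1 := wireOf_shift_par x (vals gs x) (vals (parBlocks rest).1 x)
      ((parBlocks rest).2[k]'(by simpa [parBlocks] using hk))
    rw [length_vals] at e1
    rw [e1]
    exact wireOf_parBlocks x rest (fun b hb => h b (by simp [hb])) k _ _

/-- **Depths in the juxtaposition**: the `k`-th output wire has the depth it has in the `k`-th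
block. [cite: Vollmer1999, §1.2] -/
theorem wireDepthOf_parBlocks (w : GateFn → ℕ) : ∀ (bs : List (List (Gate ι) × (ι ⊕ ℕ))),
    (∀ b ∈ bs, OutOK b.1.length b.2) → ∀ (k : ℕ) (hk : k < (parBlocks bs).2.length) (hk' : k < bs.length),
      wireDepthOf (wdepths w (parBlocks bs).1) ((parBlocks bs).2[k]) =
        wireDepthOf (wdepths w (bs[k]).1) (bs[k]).2
  | [], _, k, hk, _ => by simp [parBlocks] at hk
  | (gs, o) :: rest, h, 0, _, _ => by
    simp only [parBlocks, List.getElem_cons_zero]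
    exact wireDepthOf_wdepths_append w gs _ o (h (gs, o) (by simp))
  | (gs, o) :: rest, h, k + 1, hk, hk' => by
    simp only [parBlocks, List.getElem_cons_succ, List.getElem_map]
    rw [wdepths_append_par]
    have e1 := wireDepthOf_shift_par (ι := ι) (wdepths w gs) (wdepths w (parBlocks rest).1)
      ((parBlocks rest).2[k]'(by simpa [parBlocks] using hk))
    rw [length_wdepths] at e1
    rw [e1]
    exact wireDepthOf_parBlocks w rest (fun b hb => h b (by simp [hb])) k _ _

end GateList

/-- The unbounded fan-in gate (`∧ₖ` if `isAnd`, else `∨ₖ`) reading the wires `args`. [cite: Vollmer1999, §1.1] -/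
def bigGate (isAnd : Bool) (k : ℕ) (args : Fin k → ι ⊕ ℕ) : Gate ι :=
  ⟨k, if isAnd then (GateFn.and k).2 else (GateFn.or k).2, args⟩

/-- Its gate function is `∧ₖ` or `∨ₖ`. [folklore] -/
theorem bigGate_fn (isAnd : Bool) (k : ℕ) (args : Fin k → ι ⊕ ℕ) :
    (bigGate isAnd k args).fn = if isAnd then GateFn.and k else GateFn.or k := by
  cases isAnd <;> rfl

/-- **Unbounded fan-in `∧`/`∨` of a finite family** (Vollmer 1999, §1.2): if each `f j`
(`j : Fin M`) is realized at depth `d` with `s j` gates, then `x ↦ ⋀ⱼ f j x` (resp. `⋁ⱼ`) is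
realized at depth `d + 1` with `∑ⱼ s j + 1` gates: lay the `M` blocks side by side and add one
gate. [cite: Vollmer1999, §1.2] -/
theorem acReal_bigGate (isAnd : Bool) {M : ℕ} {f : Fin M → (ι → Bool) → Bool} {d : ℕ}
    {s : Fin M → ℕ} (h : ∀ j, ACReal (f j) d (s j)) :
    ACReal (fun x => if isAnd then decide (∀ j, f j x = true) else decide (∃ j, f j x = true))
      (d + 1) (∑ j, s j + 1) := by
  choose gs o hwf hB ho hl hdep hev using h
  set bs : List (List (Gate ι) × (ι ⊕ ℕ)) := List.ofFn fun j => (gs j, o j) with hbs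
  have hbs_len : bs.length = M := by simp [hbs]
  have hmem : ∀ b ∈ bs, ∃ j, b = (gs j, o j) := by
    intro b hb
    simp only [hbs, List.mem_ofFn] at hb
    obtain ⟨j, rfl⟩ := hb
    exact ⟨j, rfl⟩
  have hO : ∀ b ∈ bs, OutOK b.1.length b.2 := by
    intro b hb; obtain ⟨j, rfl⟩ := hmem b hb; exact ho j
  set G := (parBlocks bs).1 with hG
  set outs := (parBlocks bs).2 with houts
  have houts_len : outs.length = M := by rw [houts, length_parBlocks_snd, hbs_len]
  -- the final gate
  let args : Fin M → ι ⊕ ℕ := fun j => outs[j.1]'(by rw [houts_len]; exact j.2)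
  have hbsk : ∀ j : Fin M, bs[j.1]'(by rw [hbs_len]; exact j.2) = (gs j, o j) := by
    intro j; simp [hbs]
  have hval : ∀ (x : ι → Bool) (j : Fin M), wireOf x (vals G x) (args j) = f j x := by
    intro x j
    have := wireOf_parBlocks x bs hO j.1 (by rw [← houts, houts_len]; exact j.2)
      (by rw [hbs_len]; exact j.2)
    rw [hbsk j] at this
    rw [← hev j x]
    exact this
  have hdepj : ∀ j : Fin M, wireDepthOf (wdepths acWeight G) (args j) ≤ d := by
    intro j
    have := wireDepthOf_parBlocks acWeight bs hO j.1 (by rw [← houts, houts_len]; exact j.2)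
      (by rw [hbs_len]; exact j.2)
    rw [hbsk j] at this
    rw [show wireDepthOf (wdepths acWeight G) (args j) = _ from this]
    exact hdep j
  have hargsOK : ∀ j : Fin M, OutOK G.length (args j) := fun j =>
    outOK_parBlocks bs hO _ (List.getElem_mem _)
  refine ⟨G ++ [bigGate isAnd M args], Sum.inr G.length, ?_, ?_, ?_, ?_, ?_, fun x => ?_⟩
  · exact (wf_parBlocks bs fun b hb => by obtain ⟨j, rfl⟩ := hmem b hb; exact hwf j).append_singleton
      fun a m hm => hargsOK a m hm
  · intro g hg
    rw [List.mem_append, List.mem_singleton] at hg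
    rcases hg with hg | rfl
    · exact fn_mem_parBlocks bs (fun b hb => by obtain ⟨j, rfl⟩ := hmem b hb; exact hB j) g hg
    · rw [bigGate_fn]
      cases isAnd
      · exact or_mem_acBasis M
      · exact and_mem_acBasis M
  · intro m hm
    simp only [Sum.inr.injEq] at hm
    subst hm; simp
  · rw [List.length_append, List.length_singleton, hG, length_parBlocks_fst]
    simp only [hbs, List.map_ofFn, List.sum_ofFn, Function.comp_def]
    exact Nat.add_le_add_right (Finset.sum_le_sum fun j _ => hl j) 1
  · simp only [wireDepthOf_inr]
    rw [getD_wdepths_append_singleton, bigGate_fn]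
    have hw1 : acWeight (if isAnd = true then GateFn.and M else GateFn.or M) = 1 := by
      cases isAnd <;> simp
    rw [hw1, add_comm]
    exact Nat.add_le_add_right (Finset.sup_le fun a _ => hdepj a) 1
  · simp only [wireOf_inr]
    rw [vals_append_singleton, List.getD_eq_getElem?_getD,
      List.getElem?_append_right (by simp), length_vals, Nat.sub_self]
    simp only [List.getElem?_cons_zero, Option.getD_some, bigGate]
    cases isAnd
    · simp only [Bool.false_eq_true, if_false, GateFn.or]
      simp [hval x]
    · simp only [if_true, GateFn.and]
      simp [hval x]

/-- **Unbounded fan-in conjunction.** [cite: Vollmer1999, §1.2] -/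
theorem acReal_forall {M : ℕ} {f : Fin M → (ι → Bool) → Bool} {d : ℕ} {s : Fin M → ℕ}
    (h : ∀ j, ACReal (f j) d (s j)) :
    ACReal (fun x => decide (∀ j, f j x = true)) (d + 1) (∑ j, s j + 1) :=
  (acReal_bigGate true h).congr fun _ => by simp

/-- **Unbounded fan-in disjunction.** [cite: Vollmer1999, §1.2] -/
theorem acReal_exists {M : ℕ} {f : Fin M → (ι → Bool) → Bool} {d : ℕ} {s : Fin M → ℕ}
    (h : ∀ j, ACReal (f j) d (s j)) :
    ACReal (fun x => decide (∃ j, f j x = true)) (d + 1) (∑ j, s j + 1) :=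
  (acReal_bigGate false h).congr fun _ => by simp

/-- Conjunction over a finite index type (through an enumeration). [cite: Vollmer1999, §1.2] -/
theorem acReal_forall_fintype {κ : Type*} [Fintype κ] {f : κ → (ι → Bool) → Bool} {d s : ℕ}
    (h : ∀ k, ACReal (f k) d s) :
    ACReal (fun x => decide (∀ k, f k x = true)) (d + 1) (Fintype.card κ * s + 1) := by
  have h' : ∀ j : Fin (Fintype.card κ), ACReal (f ((Fintype.equivFin κ).symm j)) d s := fun j => h _
  refine ((acReal_forall h').congr fun x => ?_).mono le_rfl (by simp)
  simp only [decide_eq_decide]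
  exact ⟨fun H k => by simpa using H (Fintype.equivFin κ k), fun H j => H _⟩

/-- Disjunction over a finite index type (through an enumeration). [cite: Vollmer1999, §1.2] -/
theorem acReal_exists_fintype {κ : Type*} [Fintype κ] {f : κ → (ι → Bool) → Bool} {d s : ℕ}
    (h : ∀ k, ACReal (f k) d s) :
    ACReal (fun x => decide (∃ k, f k x = true)) (d + 1) (Fintype.card κ * s + 1) := by
  have h' : ∀ j : Fin (Fintype.card κ), ACReal (f ((Fintype.equivFin κ).symm j)) d s := fun j => h _
  refine ((acReal_exists h').congr fun x => ?_).mono le_rfl (by simp)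
  simp only [decide_eq_decide]
  exact ⟨fun ⟨j, hj⟩ => ⟨_, hj⟩, fun ⟨k, hk⟩ => ⟨Fintype.equivFin κ k, by simpa using hk⟩⟩

end Literature.Computability.Complexity
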